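import Literature.Probability.Percolation.IntMoveR
import Literature.Probability.Percolation.SepFourAdj
import Literature.Probability.Percolation.ArmSeparationOutSlotsFour
import Literature.Probability.Percolation.AdjDuoLanding
import HarnessLib

/-!
# The inner landing in rotated frames: confinement and the duo (first part)

Topic `Literature/Probability/Percolation`; family `crit-perc` / near-critical percolation on `𝕋`.
A brick of the INNER half of the near-critical arm-separation theorem for four arms in the ADJACENT
colour arrangement (P. Nolin, EJP 13 (2008), Thm. 11, `j = 4`, `σ = BBWW` [arXiv 0711.4948:
Thm. 10], §4.2 Def. 6–8, §4.3 Prop. 12, §4.4, internal extremities). Bookkeeping between the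
landed single-arm event of a rotated, recoloured, RESTRICTED configuration and the confined fenced
arm events `sepArmAt i b X n N` of `sepFourAdj`:

* `sepOpenArmIn_of_inter` — `ω ∩ X ∈ sepOpenArm n N → ω ∈ sepOpenArmIn X n N`;
* `rotConfig_colCfg_eq_readFrame` — `rotConfig i (colCfg b ω) = readFrame i b ω`;
* `sepArmAt_of_rot_inter` — `rotConfig i (colCfg b ω) ∩ X ∈ sepOpenArm n N → ω ∈ sepArmAt i b (ρ^i '' X) n N`;
* `sepArmDuo_of_rot_inter` — two such arms on the sides `i`, `i + 1` with disjoint actual regions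
  give `sepArmDuo i b n N`; `sepFourAdj_of_rot_inter`;
* `IntExit.restrictTo`, `inLandRegion`, `sepOpenArm_inter_of_intExit` — the CONFINED inner landing
  move (the configuration restricted to the region of the move still carries the landed arm).

Everything here is proved; no named facts are introduced.

## References

* P. Nolin, Near-critical percolation in two dimensions, *Electron. J. Probab.* 13 (2008), §4.2
  Def. 6–8 and §4.4, internal extremities (arXiv 0711.4948: Def. 6–8, Thm. 10) [Nolin2008].
-/

noncomputable section

open Set

namespace Literature.Probability.Percolation

open LatticeModels Tube

/-- **A landed arm of the restricted configuration is a confined landed arm.** [folklore] -/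
theorem sepOpenArmIn_of_inter {X : Set (Site 2)} {n N : ℕ} {ω : SiteConfig (Site 2)} (h : (ω ∩ X : Set (Site 2)) ∈ sepOpenArm n N) :
    ω ∈ sepOpenArmIn X n N := by
  obtain ⟨z, z', u, u', hz, hz', ⟨b, t, hb, ht, p₁, p₂⟩, ⟨b', t', hb', ht', p₃, p₄⟩, p₅⟩ := h
  have m : ∀ F : Set (Site 2), F ∩ (ω ∩ X) ⊆ F ∩ X ∩ ω := fun F v hv => ⟨⟨hv.1, hv.2.2⟩, hv.2.1⟩
  exact ⟨z, z', u, u', hz, hz', ⟨b, t, hb, ht, p₁.mono (m _), p₂.mono (m _)⟩, ⟨b', t', hb', ht', p₃.mono (m _), p₄.mono (m _)⟩,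
    p₅.mono (m _)⟩

/-- Rotating the recoloured configuration is reading it in the frame. [folklore] -/
theorem rotConfig_colCfg_eq_readFrame (i : ℕ) (b : Bool) (ω : SiteConfig (Site 2)) : rotConfig i (colCfg b ω) = readFrame i b ω := by
  ext v; rw [mem_rotConfig, mem_readFrame]; rfl

/-- **From a landed arm of the rotated, recoloured, restricted configuration to the confined fenced
arm of colour `b` on the side `i`.** [cite: Nolin2008, §4.2 Def. 6–8 (arXiv 0711.4948: Def. 6–8)] -/
theorem sepArmAt_of_rot_inter {i : ℕ} {b : Bool} {X : Set (Site 2)} {n N : ℕ} {ω : SiteConfig (Site 2)}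
    (h : (rotConfig i (colCfg b ω) ∩ X : Set (Site 2)) ∈ sepOpenArm n N) : ω ∈ sepArmAt i b (triRotIsoPow i '' X) n N := by
  rw [mem_sepArmAt, ← rotConfig_colCfg_eq_readFrame]
  have hpre : (triRotIsoPow i) ⁻¹' (triRotIsoPow i '' X) = X :=
    Set.preimage_image_eq X (triRotIsoPow i).injective
  rw [hpre]
  exact sepOpenArmIn_of_inter h

/-- **Two confined fenced arms of colour `b` on the consecutive sides `i`, `i + 1` with disjoint
actual regions form `sepArmDuo i b`.** [cite: Nolin2008, §4.2 Def. 6–8 (arXiv 0711.4948: Def. 6–8), σ = BBWW] -/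
theorem sepArmDuo_of_rot_inter {i : ℕ} {b : Bool} {X Y : Set (Site 2)} {n N : ℕ} {ω : SiteConfig (Site 2)}
    (hX : (rotConfig i (colCfg b ω) ∩ X : Set (Site 2)) ∈ sepOpenArm n N)
    (hY : (rotConfig (i + 1) (colCfg b ω) ∩ Y : Set (Site 2)) ∈ sepOpenArm n N)
    (hXY : Disjoint (triRotIsoPow i '' X) (triRotIsoPow (i + 1) '' Y)) : ω ∈ sepArmDuo i b n N :=
  ⟨_, _, hXY, sepArmAt_of_rot_inter hX, sepArmAt_of_rot_inter hY⟩

/-- **The well-separated four-arm event with adjacent colours from four landed arms of the rotated,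
recoloured, restricted configurations** (open on the sides `0`, `1`, closed on the sides `3`, `4`). [cite: Nolin2008, §4.2 Def. 8 and §4.3 Thm. 11 (arXiv 0711.4948: Def. 7, Thm. 10), σ = BBWW] -/
theorem sepFourAdj_of_rot_inter {X₀ X₁ X₃ X₄ : Set (Site 2)} {n N : ℕ} {ω : SiteConfig (Site 2)}
    (h₀ : (rotConfig 0 (colCfg true ω) ∩ X₀ : Set (Site 2)) ∈ sepOpenArm n N)
    (h₁ : (rotConfig 1 (colCfg true ω) ∩ X₁ : Set (Site 2)) ∈ sepOpenArm n N)
    (h₃ : (rotConfig 3 (colCfg false ω) ∩ X₃ : Set (Site 2)) ∈ sepOpenArm n N)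
    (h₄ : (rotConfig 4 (colCfg false ω) ∩ X₄ : Set (Site 2)) ∈ sepOpenArm n N)
    (h₀₁ : Disjoint (triRotIsoPow 0 '' X₀) (triRotIsoPow 1 '' X₁)) (h₃₄ : Disjoint (triRotIsoPow 3 '' X₃) (triRotIsoPow 4 '' X₄)) :
    ω ∈ sepFourAdj n N :=
  ⟨sepArmDuo_of_rot_inter h₀ h₁ h₀₁, sepArmDuo_of_rot_inter h₃ h₄ h₃₄⟩

/-! ### The confined landing move -/

namespace IntExit

variable {m k₀ K : ℕ} {A : Set (Site 2)} {χ : SiteConfig (Site 2)}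

/-- **Transfer to another configuration** containing the route and the open sites of the corner box. [folklore] -/
def restrictTo (F : IntExit m A k₀ K χ) (χ' : SiteConfig (Site 2)) {S : Set (Site 2)} (hP : PathIn triGraph S F.b F.m')
    (hS : S ⊆ (A ∪ intExitZone m F.z F.k) ∩ χ) (hSχ : S ⊆ χ')
    (hbox : triStrip (F.z 0 - 2 * F.k) (F.z 1 + F.k) F.k F.k ∩ (χ : Set (Site 2)) ⊆ χ') : IntExit m A k₀ K χ' where
  z := F.z
  j := F.j
  m' := F.m'
  b := F.b
  z_isIntJ := F.z_isIntJ
  j_lt := F.j_lt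
  b_far := F.b_far
  vcross := by
    obtain ⟨b, t, hb, ht, Pb, Pt⟩ := F.vcross
    exact ⟨b, t, hb, ht, Pb.mono fun v hv => ⟨hv.1, hbox hv⟩, Pt.mono fun v hv => ⟨hv.1, hbox hv⟩⟩
  path := hP.mono fun v hv => ⟨(hS hv).1, hSχ hv⟩

/-- `restrictTo` keeps the tip. [folklore] -/
@[simp] theorem restrictTo_z (F : IntExit m A k₀ K χ) (χ' : SiteConfig (Site 2)) {S : Set (Site 2)} (hP : PathIn triGraph S F.b F.m')
    (hS : S ⊆ (A ∪ intExitZone m F.z F.k) ∩ χ) (hSχ : S ⊆ χ')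
    (hbox : triStrip (F.z 0 - 2 * F.k) (F.z 1 + F.k) F.k F.k ∩ (χ : Set (Site 2)) ⊆ χ') : (F.restrictTo χ' hP hS hSχ hbox).z = F.z := rfl

/-- `restrictTo` keeps the scale. [folklore] -/
@[simp] theorem restrictTo_k (F : IntExit m A k₀ K χ) (χ' : SiteConfig (Site 2)) {S : Set (Site 2)} (hP : PathIn triGraph S F.b F.m')
    (hS : S ⊆ (A ∪ intExitZone m F.z F.k) ∩ χ) (hSχ : S ⊆ χ')
    (hbox : triStrip (F.z 0 - 2 * F.k) (F.z 1 + F.k) F.k F.k ∩ (χ : Set (Site 2)) ⊆ χ') : (F.restrictTo χ' hP hS hSχ hbox).k = F.k := rfl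

/-- `restrictTo` keeps the far end. [folklore] -/
@[simp] theorem restrictTo_b (F : IntExit m A k₀ K χ) (χ' : SiteConfig (Site 2)) {S : Set (Site 2)} (hP : PathIn triGraph S F.b F.m')
    (hS : S ⊆ (A ∪ intExitZone m F.z F.k) ∩ χ) (hSχ : S ⊆ χ')
    (hbox : triStrip (F.z 0 - 2 * F.k) (F.z 1 + F.k) F.k F.k ∩ (χ : Set (Site 2)) ⊆ χ') : (F.restrictTo χ' hP hS hSχ hbox).b = F.b := rfl

end IntExit

/-- **The region of the confined inner landing move**: the `ρ^i`-images of the spoke box, the exit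
zone, the corner box and the route, together with the annulus part used (arc boxes, approach and
target strips) and the outer free space. [folklore] -/
def inLandRegion (i m : ℕ) (S : Set (Site 2)) (z : Site 2) (k : ℕ) (T₀ : ℤ) (w L ε r e s a len n : ℕ) (t : ℤ) (W N : ℕ) (zo : Site 2) :
    Set (Site 2) :=
  triRotIsoPow i '' ((inSpokeTube m k T₀ w L ε).box ∪ intExitZone m z k ∪ triStrip (z 0 - 2 * k) (z 1 + k) k k ∪ S) ∪
    (boxAll (arc (thinRing r e s) a len) ∪ triStrip ((n : ℤ) - (n / 8 : ℕ) + 1) t W (n / 64) ∪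
      triStrip ((n : ℤ) - (n / 8 : ℕ) + 1) (t - (n / 64 : ℕ)) (n / 8 - 2) (2 * (n / 64)) ∪ sepOuterFence N zo)

/-- **The confined inner landing move**: under the hypotheses of `sepOpenArm_of_intExit` (with an
explicit route `S` of the exit), the configuration RESTRICTED to `inLandRegion` carries the landed
arm. [cite: Nolin2008, §4.3 Prop. 12 and §4.4, internal extremities (arXiv 0711.4948: Prop. 11, Thm. 10, p. 13)] -/
theorem sepOpenArm_inter_of_intExit {m n N k₀ K : ℕ} {i : ℕ} (hi : i < 6) {χ : SiteConfig (Site 2)} {zo uo : Site 2}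
    (hzo : zo ∈ sepLanding N)
    (hOut : OpenVCrossThrough (sepOuterFence N zo) (zo 1 - (N / 64 : ℕ)) (zo 1 + (N / 64 : ℕ)) χ uo)
    {A : Set (Site 2)} (hA : triRotIsoPow i '' A ⊆ triAnnulusSet n N ∪ triOpenBall zo (N / 8))
    (F : IntExit m A k₀ K (rotConfig i χ)) (hb : triRotIsoPow i F.b = uo)
    {S : Set (Site 2)} (hP : PathIn triGraph S F.b F.m') (hS : S ⊆ (A ∪ intExitZone m F.z F.k) ∩ rotConfig i χ)
    {R₀ : ℕ} (hmid : -(m : ℤ) + R₀ ≤ F.z 1 ∧ F.z 1 ≤ -(R₀ : ℤ)) (hR : 8 * F.k + 2 ≤ R₀)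
    {T₀ : ℤ} {w : ℕ} (hwin : T₀ ≤ F.z 1 ∧ F.z 1 < T₀ + w)
    {L ε : ℕ} (hfit : (w : ℤ) + (F.k / 4 : ℕ) + 2 * ε ≤ F.k) (hL : F.k + 1 ≤ L) (hSp : χ ∈ inSpokeEvent i m F.k T₀ w L ε)
    {r e s a len : ℕ} (hs : 1 ≤ s) (hsr : s ∣ r) (hsr' : s ≤ r) (he : 2 * e ≤ r)
    (harc : χ ∈ eventAll (arc (thinRing r e s) a len))
    {Te : Tube} (hTe : Te ∈ arc (thinRing r e s) a len) (hJ : SpokeMeetsRot i (inSpokeTube m F.k T₀ w L ε) Te)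
    {t : ℤ} (ht : -(n : ℤ) + (n / 4 : ℕ) + (n / 16 : ℕ) ≤ t ∧ t ≤ -((n / 4 : ℕ) : ℤ) - (n / 16 : ℕ))
    {j₀ d : ℕ} (hSL : ∀ T ∈ vchunks r (-(r : ℤ)) e s j₀ (d + 1), T ∈ arc (thinRing r e s) a len)
    (hlo : -(r : ℤ) + j₀ * s - e ≤ t) (hhi : t + (n / 64 : ℕ) ≤ -(r : ℤ) + (j₀ + d) * s - e)
    {W : ℕ} (hW : (n : ℤ) - (n / 8 : ℕ) + 1 + W = r + 2 * e) (hH : χ ∈ tgtH n t W) (hV : χ ∈ tgtV n t)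
    (hn : 64 ≤ n) (hnr : (n : ℤ) + s + 2 * e ≤ r) (hrm : (r : ℤ) + 2 * e ≤ (m : ℤ) - F.k - L) (hLm : (F.k : ℤ) + L + R₀ ≤ m)
    (hmN : (m : ℤ) + 6 * F.k + 1 ≤ N) :
    (χ ∩ inLandRegion i m S F.z F.k T₀ w L ε r e s a len n t W N zo : Set (Site 2)) ∈ sepOpenArm n N := by
  set R := inLandRegion i m S F.z F.k T₀ w L ε r e s a len n t W N zo with hR'
  -- the pieces of the region
  have hRsp : triRotIsoPow i '' (inSpokeTube m F.k T₀ w L ε).box ⊆ R := fun v ⟨u, hu, e⟩ => Or.inl ⟨u, Or.inl (Or.inl (Or.inl hu)), e⟩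
  have hRS : ∀ u ∈ S ∪ triStrip (F.z 0 - 2 * F.k) (F.z 1 + F.k) F.k F.k, triRotIsoPow i u ∈ R := by
    rintro u (hu | hu)
    · exact Or.inl ⟨u, Or.inr hu, rfl⟩
    · exact Or.inl ⟨u, Or.inl (Or.inr hu), rfl⟩
  have hRarc : boxAll (arc (thinRing r e s) a len) ⊆ R := fun v hv => Or.inr (Or.inl (Or.inl (Or.inl hv)))
  have hRH : triStrip ((n : ℤ) - (n / 8 : ℕ) + 1) t W (n / 64) ⊆ R := fun v hv => Or.inr (Or.inl (Or.inl (Or.inr hv)))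
  have hRV : triStrip ((n : ℤ) - (n / 8 : ℕ) + 1) (t - (n / 64 : ℕ)) (n / 8 - 2) (2 * (n / 64)) ⊆ R := fun v hv => Or.inr (Or.inl (Or.inr hv))
  have hRO : sepOuterFence N zo ⊆ R := fun v hv => Or.inr (Or.inr hv)
  -- the hypotheses for the restricted configuration
  have hOut' : OpenVCrossThrough (sepOuterFence N zo) (zo 1 - (N / 64 : ℕ)) (zo 1 + (N / 64 : ℕ)) (χ ∩ R) uo := by
    obtain ⟨b, t', hb', ht', Pb, Pt⟩ := hOut
    exact ⟨b, t', hb', ht', Pb.mono fun v hv => ⟨hv.1, hv.2, hRO hv.1⟩, Pt.mono fun v hv => ⟨hv.1, hv.2, hRO hv.1⟩⟩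
  have hrot : rotConfig i (χ ∩ R) = rotConfig i χ ∩ (triRotIsoPow i) ⁻¹' R := rotConfig_inter i χ R
  let F' : IntExit m A k₀ K (rotConfig i (χ ∩ R)) :=
    { z := F.z, j := F.j, m' := F.m', b := F.b, z_isIntJ := F.z_isIntJ, j_lt := F.j_lt, b_far := F.b_far
      vcross := by
        obtain ⟨b, t', hb', ht', Pb, Pt⟩ := F.vcross
        exact ⟨b, t', hb', ht', Pb.mono fun v hv => ⟨hv.1, by rw [hrot]; exact ⟨hv.2, hRS v (Or.inr hv.1)⟩⟩,
          Pt.mono fun v hv => ⟨hv.1, by rw [hrot]; exact ⟨hv.2, hRS v (Or.inr hv.1)⟩⟩⟩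
      path := hP.mono fun v hv => ⟨(hS hv).1, by rw [hrot]; exact ⟨(hS hv).2, hRS v (Or.inl hv)⟩⟩ }
  have hSp' : (χ ∩ R : Set (Site 2)) ∈ inSpokeEvent i m F'.k T₀ w L ε := by
    show rotConfig i (χ ∩ R) ∈ (inSpokeTube m F.k T₀ w L ε).event
    rw [hrot]
    exact Tube.event_inter hSp fun u hu => hRsp ⟨u, hu, rfl⟩
  have harc' : (χ ∩ R : Set (Site 2)) ∈ eventAll (arc (thinRing r e s) a len) := eventAll_inter harc hRarc
  have hH' : (χ ∩ R : Set (Site 2)) ∈ tgtH n t W := triHCross_inter hH hRH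
  have hV' : (χ ∩ R : Set (Site 2)) ∈ tgtV n t := triVCross_inter hV hRV
  have key := sepOpenArm_of_intExit hi hzo hOut' hA F' hb hmid hR hwin hfit hL hSp' hs hsr hsr' he harc' hTe hJ ht hSL hlo hhi hW hH' hV'
    hn hnr hrm hLm hmN
  exact key

end Literature.Probability.Percolation
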